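/-
Copyright (c) 2026 the pub-hodgecm-mathlib formalisation cell (harness21).  Prover seat hodgecm-mathlib-LH4-p05 (g2): Track A «(D-RAM) FOUR-FRAME» squad of crux H413,
TIER-2 file paying the ED. 7 child **(ρ3b′) `stub_U2H_hProfiles_levi_ratio_wild`** of `Cruxes/H413/Lines/F0_P3c_DyRamFourFrame_U2H_HSide.lean` BY NAME
(dealer LH4-plan WORD #46 «p05 (g2) … the (f)-(A)∕(B) payer when ED. 7 registers it»; cutter LH4-p06 (g2); ν-reconciled intrinsic volume form).  2026-09-04.
-/
import Summits.HodgeConjecture.HodgeConjecture.Theorems.F0P3cDyRamFourFrameHFamilyDefs        -- DEFS LEAF №5 (LH4-p03): `hFamily = ![hProfileZero, hProfileSharp]`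
import Literature.NumberTheory.Rogawski1990.DepthZeroTransferHValuesLeviIndicator              -- F8 (this seat, p856091): the `h₀ = 1_{K_H}` Levi row `Φ^st = ν_H(K_H)·J_H` (same `J_H` token)
import Literature.NumberTheory.Rogawski1990.DepthZeroTransferHValuesLeviRamifiedModularUnit    -- ★ F5 p855941 (this seat): the `h₁` Levi row at a √u-type place, `ν_H(K_H)·J_H·2∕(q+1)`
import Literature.NumberTheory.Rogawski1990.DepthZeroTransferHValuesLeviRamifiedModularOdd     -- ★ p855329 (LH4-p05 (g0)): the `h₁` Levi row at a √π-type place, `ν_H(K_H)·J_H·(q+1)∕2`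
import Literature.NumberTheory.Automorphic.UnitaryTwoVertexEdgeStabilizerMassRatioRamifiedUnit -- ★ F6 p855992 (this seat): `(q+1)·ν_H(K♯ × U₁) = 2·ν_H(K⁰ × U₁)` at a √u-type place
import Literature.NumberTheory.Automorphic.UnitaryTwoVertexEdgeStabilizerMassRatioRamifiedOdd  -- ★ F7 p855993 (this seat): `2·ν_H(K♯ × U₁) = (q+1)·ν_H(K⁰ × U₁)` at a √π-type place
import Literature.NumberTheory.Rogawski1990.FinExplicitTransferFactorLeviStratumGerm            -- ★ p855542 (LH4-p07 (g2)): `exists_nhds_one_forall_levi_valued_sub_one_le` (near `1`, Levi ⇒ deep), ★ `endoEmbLocal_eq_glDiagonal_of_fst_eq`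
import Literature.NumberTheory.Rogawski1990.RankOneKappaVertexCoverWild                        -- ★ `exists_vertexCover_of_ramified_wild` (`K♯` as a subgroup at ANY ramified place)
import Literature.NumberTheory.Automorphic.RamifiedPlaceAntiFixedDichotomy                       -- ★ `exists_units_galAdicCompletionMap_complexConj_eq_neg_of_ramified` (√u ∕ √π dichotomy)
import Literature.NumberTheory.Automorphic.UnitaryTwoEdgeStabilizerResidualDichotomyRamified     -- ★ `forall_v_sharp_iff_coe_mem_map_conj` (`P♯ ↔ ∈ D GL₂(𝒪_w) D⁻¹`)
import HarnessLib

/-!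
# (ρ3b′) PAID: the Levi values of the two vertex-type profiles in intrinsic volume currency

Cell `hodgecm-mathlib` (D-0151), FLOOR 0, crux item H413 = `stmt-HodgeConjecture-24833`, route of record `HCCMUnconditional`; squad F0∕P3c∕LH4; tier-1 module
`Cruxes/H413/Lines/F0_P3c_DyRamFourFrame_U2H_HSide.lean` (ED. 7–10), §1c child **(ρ3b′) `stub_U2H_hProfiles_levi_ratio_wild`** (cutter LH4-p06 (g2), dealer LH4-plan,
payer = LH4-p05 lineage).  THEOREMS ONLY (no `def`, no instance, no notation, no `sorry`, default heartbeats); lane `--supports stmt-HodgeConjecture-24833` (count-neutral).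

WHAT IS PROVED.  `hProfiles_levi_ratio_wild` — the statement of the stub TOKEN FOR TOKEN (typed under this module's `open scoped … ValuativeRel`, so that the idle binder
`_h2 : ¬ IsUnit (2 : 𝒪[L_w])` elaborates as in the Lines module, REF1 m56): at a ramified non-split CM place `w ∣ v` with a uniformiser `ϖ`, for a canonical family `mH`
(at `IsLocalGRegular`, Haar `νH`), there is `V ∈ 𝓝 (1 : H_v)` such that for every `G`-regular `γ_H ∈ V` that is `H_v`-conjugate to a diagonal,
`νH(supp h₀) · Φ^st(γ_H, h₁) = νH(supp h₁) · Φ^st(γ_H, h₀)`, `h_s = hFamily L w hw ϖ s` (`h₀ = 1_{K_H}`, `h₁ = 1_{K♯ × U₁}`).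

THE PROOF (four ★ rows and a dichotomy; no new mathematics in this file).
* `V` = ★ p855542's uniform neighbourhood `exists_nhds_one_forall_levi_valued_sub_one_le` at `c = ϖ`: on `V` every Levi witness `(yγ_Hy⁻¹)₁ = diag(d′)` is deep, `|d′ᵢ,w − 1| ≤ |ϖ| < 1`.
* `supp h₀ = K_H = K⁰ × U₁` (`U₁ = U(Φ₁)(𝒪_v) = U(Φ₁)(L⁺_v)`, ★ `cmLocalIntegralLevel_one_eq_top_of_smul_eq`) and `supp h₁ = K♯ × U₁`, `K♯ = E₂⁻¹(U ∩ D_η GL₂(𝒪_w) D_η⁻¹)` for ANY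
  uniformiser `η` (★ `exists_vertexCover_of_ramified_wild`, ★ `forall_v_sharp_iff_coe_mem_map_conj`; the `P♯` text depends on `η` only through `|η|`) — §1.
* `Φ^st(γ_H, h₀) = νH(K_H)·J_H` at any non-split place (F8 `stableOrbitalIntegralRel_indicator_prod_eq_of_levi_frame_of_nonsplit`).
* ★ `exists_units_galAdicCompletionMap_complexConj_eq_neg_of_ramified`: an anti-fixed `α` with `|α| = 1` (√u-type) or `|α| = |ϖ|` (√π-type).
  √u: `Φ^st(γ_H, h₁) = νH(K_H)·J_H·2∕(q+1)` (★ F5 p855941) and `(q+1)·νH(K♯ × U₁) = 2·νH(K⁰ × U₁)` (★ F6 p855992);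
  √π: `Φ^st(γ_H, h₁) = νH(K_H)·J_H·(q+1)∕2` (★ p855329) and `2·νH(K♯ × U₁) = (q+1)·νH(K⁰ × U₁)` (★ F7 p855993, with `η = α`).
  In both types both sides equal `νH(K_H)·νH(K♯ × U₁)·J_H` — a parity-, `d`-, `t`-free identity, as the cutter's (R-13) risk line predicted.
* §1 `support_hFamily_zero_eq`, `support_hFamily_one_eq` (the two supports as product subgroups); §2 HEAD **`hProfiles_levi_ratio_wild`**.

HONEST LABEL: HC_CM is proved only modulo the 7 printed citations (2 remaining named inputs: hLiu418 = `stmt-HodgeConjecture-24832`, h413 = `stmt-HodgeConjecture-24833`) until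
rung 0 closes; this file is unconditional, pays ONE registered stub by name and freezes no other stub text.

## References
* [Rogawski1990] J. D. Rogawski, *Automorphic Representations of Unitary Groups in Three Variables*, Ann. of Math. Stud. 123 (1990), §4.3 (4.3.1) p. 43; §4.9 pp. 54–56, Prop. 4.9.1 (b), Lemma 4.9.3.
* [Kottwitz1986BaseChangeUnits] R. E. Kottwitz, *Base change for unit elements of Hecke algebras*, Compositio Math. 60 (1986), §1 pp. 240–241.
* [Tits1979] J. Tits, *Reductive groups over local fields*, PSPM 33.1 (1979), §3.7 (Iwahori subgroups; volumes of parahorics).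
* [Serre1980Trees] J.-P. Serre, *Trees* (1980), Ch. II §1.3 (vertex and edge stabilisers in `SL₂` of a local field).
* [Jacobowitz1962] R. Jacobowitz, *Hermitian forms over local fields*, Amer. J. Math. 84 (1962), §5 (the two ramified dyadic types `L_w = L⁺_v(√u)`, `L⁺_v(√π)`).
-/

set_option autoImplicit false

noncomputable section

namespace Summit.HodgeConjecture.HodgeConjecture.Cruxes.H413.F0P3cDyRamHProfilesLeviRatio

open MeasureTheory Measure NumberField IsDedekindDomain Topology Filter
open Literature.NumberTheory.Automorphic Literature.NumberTheory.Automorphic.UnitaryGroup Literature.NumberTheory.Automorphic.IntegralReduction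
open Literature.NumberTheory.Rogawski1990 Literature.NumberTheory.GaloisRepresentations
open Summit.HodgeConjecture.HodgeConjecture.Cruxes.H413.F0P3cDyRamFourFrameHFamilyDefs
open scoped Matrix MatrixGroups Classical ValuativeRel

/-! ## §1 The supports of the two profiles as product subgroups -/

section Supports

variable (L : Type) [Field L] [NumberField L] [IsCMField L] {v : HeightOneSpectrum (𝓞 ↥(maximalRealSubfield L))}
  (w : UnitaryGroup.PlacesOver L v) (hw : IsCMField.complexConj L • w.1 = w.1)

include hw in
/-- **`supp h₀ = K⁰ × U₁`**: the support of `hFamily … 0 = hProfileZero = 1_{K₂ × K₁}` is `K₂ × U(Φ₁)(L⁺_v)` — at a non-split place the rank-one integral level `K₁` is all of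
`U(Φ₁)(L⁺_v)` (★ `cmLocalIntegralLevel_one_eq_top_of_smul_eq`). [cite: Rogawski1990, §4.9 p. 54] -/
theorem support_hFamily_zero_eq (ϖ : w.1.adicCompletion L) :
    Function.support (hFamily L w hw ϖ 0) = ((((cmLocalIntegralLevel L 2 (Matrix.of fun i j : Fin 2 => if i.val + j.val + 1 = 2 then (1 : L) else 0) v).prod (⊤ : Subgroup ((UnitaryGroup.cmDatum L 1 (Matrix.of fun i j : Fin 1 => if i.val + j.val + 1 = 1 then (1 : L) else 0)).Local v))) : Subgroup ((UnitaryGroup.cmDatum L 2 (Matrix.of fun i j : Fin 2 => if i.val + j.val + 1 = 2 then (1 : L) else 0)).Local v × (UnitaryGroup.cmDatum L 1 (Matrix.of fun i j : Fin 1 => if i.val + j.val + 1 = 1 then (1 : L) else 0)).Local v)) : Set ((UnitaryGroup.cmDatum L 2 (Matrix.of fun i j : Fin 2 => if i.val + j.val + 1 = 2 then (1 : L) else 0)).Local v × (UnitaryGroup.cmDatum L 1 (Matrix.of fun i j : Fin 1 => if i.val + j.val + 1 = 1 then (1 : L) else 0)).Local v)) := by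
  have hK1 : cmLocalIntegralLevel L 1 (Matrix.of fun i j : Fin 1 => if i.val + j.val + 1 = 1 then (1 : L) else 0) v = ⊤ :=
    cmLocalIntegralLevel_one_eq_top_of_smul_eq L _ w hw (isUnit_placeForm_antidiagOne (E := L) 1 w.1)
  show Function.support (Set.indicator (((cmLocalIntegralLevel L 2 (Matrix.of fun i j : Fin 2 => if i.val + j.val + 1 = 2 then (1 : L) else 0) v).prod (cmLocalIntegralLevel L 1 (Matrix.of fun i j : Fin 1 => if i.val + j.val + 1 = 1 then (1 : L) else 0) v) : Subgroup ((UnitaryGroup.cmDatum L 2 (Matrix.of fun i j : Fin 2 => if i.val + j.val + 1 = 2 then (1 : L) else 0)).Local v × (UnitaryGroup.cmDatum L 1 (Matrix.of fun i j : Fin 1 => if i.val + j.val + 1 = 1 then (1 : L) else 0)).Local v)) : Set ((UnitaryGroup.cmDatum L 2 (Matrix.of fun i j : Fin 2 => if i.val + j.val + 1 = 2 then (1 : L) else 0)).Local v × (UnitaryGroup.cmDatum L 1 (Matrix.of fun i j : Fin 1 => if i.val + j.val + 1 = 1 then (1 : L) else 0)).Local v)) (fun _ => (1 : ℂ))) =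 _
  rw [Set.support_indicator, Function.support_const one_ne_zero, Set.inter_univ, hK1]

include hw in
/-- **`supp h₁ = K♯ × U₁`** for ANY subgroup `K₂1` with the `D_η`-conjugate-level membership (`η` any uniformiser, `|η| = |ϖ|`): the set-builder of `hProfileSharp`
`{h | ∀ a b, |ϖ^b ϖ^{−a} (E₂ h₁)_{ab}| ≤ 1}` IS `E₂⁻¹(U ∩ D_η GL₂(𝒪_w) D_η⁻¹) × U₁` (★ `forall_v_sharp_iff_coe_mem_map_conj`; the text sees `η` only through `|η|`).
[cite: Tits1979, §3.7] [cite: Serre1980Trees, Ch. II §1.3] -/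
theorem support_hFamily_one_eq (ϖ : w.1.adicCompletion L) (η : (w.1.adicCompletion L)ˣ) (hη : Valued.v (η : w.1.adicCompletion L) = Valued.v ϖ)
    (K₂1 : Subgroup ((UnitaryGroup.cmDatum L 2 (Matrix.of fun i j : Fin 2 => if i.val + j.val + 1 = 2 then (1 : L) else 0)).Local v))
    (hd1' : ∀ g : (UnitaryGroup.cmDatum L 2 (Matrix.of fun i j : Fin 2 => if i.val + j.val + 1 = 2 then (1 : L) else 0)).Local v, g ∈ K₂1 ↔ (((localNonsplitEquiv (IsCMField.complexConj L) (Matrix.of fun i j : Fin 2 => if i.val + j.val + 1 = 2 then (1 : L) else 0) (IsCMField.complexConj_ne_one L) w hw) g : ↥(unitaryGroupOfForm (galAdicCompletionMap (L := L) (IsCMField.complexConj L) hw) (placeForm (Matrix.of fun i j : Fin 2 => if i.val + j.val + 1 = 2 then (1 : L) else 0) w.1))) : GL (Fin 2) (w.1.adicCompletion L)) ∈ (glInt 2 (w.1.adicCompletion L)).map (MulAut.conj (glDiagonal 2 (w.1.adicCompletion L) ![1, η])).toMonoidHom) :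
    Function.support (hFamily L w hw ϖ 1) = (((K₂1.prod (⊤ : Subgroup ((UnitaryGroup.cmDatum L 1 (Matrix.of fun i j : Fin 1 => if i.val + j.val + 1 = 1 then (1 : L) else 0)).Local v))) : Subgroup ((UnitaryGroup.cmDatum L 2 (Matrix.of fun i j : Fin 2 => if i.val + j.val + 1 = 2 then (1 : L) else 0)).Local v × (UnitaryGroup.cmDatum L 1 (Matrix.of fun i j : Fin 1 => if i.val + j.val + 1 = 1 then (1 : L) else 0)).Local v)) : Set ((UnitaryGroup.cmDatum L 2 (Matrix.of fun i j : Fin 2 => if i.val + j.val + 1 = 2 then (1 : L) else 0)).Local v × (UnitaryGroup.cmDatum L 1 (Matrix.of fun i j : Fin 1 => if i.val + j.val + 1 = 1 then (1 : L) else 0)).Local v)) := by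
  show Function.support (hProfileSharp L w hw ϖ) = _
  unfold hProfileSharp
  rw [Set.support_indicator, Function.support_const one_ne_zero, Set.inter_univ]
  ext x
  rw [Set.mem_setOf_eq, SetLike.mem_coe, Subgroup.mem_prod, hd1' x.1, ← forall_v_sharp_iff_coe_mem_map_conj L w hw η]
  simp only [Subgroup.mem_top, and_true, map_mul, map_inv₀, map_pow, hη]

end Supports

/-! ## §2 HEAD: (ρ3b′) token for token -/

/-- **(ρ3b′) `stub_U2H_hProfiles_levi_ratio_wild` PAID**: near `1 ∈ H_v`, on the Levi population, `νH(supp h₀) · Φ^st(γ_H, h₁) = νH(supp h₁) · Φ^st(γ_H, h₀)` for `h_s = hFamily … s`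
— both sides are `νH(K_H)·νH(K♯ × U₁)·J_H(γ_H)`: the `h₀` row (F8) `Φ^st(γ_H, 1_{K_H}) = νH(K_H)·J_H`, and by the √u ∕ √π dichotomy of the ramified place the `h₁` row
`νH(K_H)·J_H·R` (★ F5 `R = 2∕(q+1)` ∕ ★ p855329 `R = (q+1)∕2`) against the volume identity `νH(K♯ × U₁) = R·νH(K⁰ × U₁)` (★ F6 ∕ ★ F7).  `V` = ★ p855542's uniform neighbourhood
(Levi witnesses are `ϖ`-deep on it); the idle binder `_h2` is carried for the by-name pay.
[cite: Rogawski1990, §4.9 Prop. 4.9.1 (b) p. 55, Lemma 4.9.3 p. 56; §4.3 (4.3.1) p. 43] [cite: Kottwitz1986BaseChangeUnits, §1 pp. 240–241] [cite: Tits1979, §3.7] [cite: Jacobowitz1962, §5] -/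
theorem hProfiles_levi_ratio_wild :
    ∀ (L : Type) [Field L] [NumberField L] [IsCMField L]
      {v : HeightOneSpectrum (𝓞 ↥(maximalRealSubfield L))} (w : UnitaryGroup.PlacesOver L v)
      (hw : IsCMField.complexConj L • w.1 = w.1) (he : v.asIdeal.ramificationIdx' w.1.asIdeal ≠ 1)
      (_h2 : ¬ IsUnit (2 : 𝒪[w.1.adicCompletion L]))
      (ϖ : (w.1.adicCompletion L)) (hϖ : Valued.v ϖ = WithZero.exp (-1 : ℤ))
      [MeasurableSpace ((UnitaryGroup.cmDatum L 2 (Matrix.of fun i j : Fin 2 => if i.val + j.val + 1 = 2 then (1 : L) else 0)).Local v × (UnitaryGroup.cmDatum L 1 (Matrix.of fun i j : Fin 1 => if i.val + j.val + 1 = 1 then (1 : L) else 0)).Local v)] [BorelSpace ((UnitaryGroup.cmDatum L 2 (Matrix.of fun i j : Fin 2 => if i.val + j.val + 1 = 2 then (1 : L) else 0)).Local v × (UnitaryGroup.cmDatum L 1 (Matrix.of fun i j : Fin 1 => if i.val + j.val + 1 = 1 then (1 : L) else 0)).Local v)]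
      [∀ a : ((UnitaryGroup.cmDatum L 2 (Matrix.of fun i j : Fin 2 => if i.val + j.val + 1 = 2 then (1 : L) else 0)).Local v × (UnitaryGroup.cmDatum L 1 (Matrix.of fun i j : Fin 1 => if i.val + j.val + 1 = 1 then (1 : L) else 0)).Local v), MeasurableSpace (((UnitaryGroup.cmDatum L 2 (Matrix.of fun i j : Fin 2 => if i.val + j.val + 1 = 2 then (1 : L) else 0)).Local v × (UnitaryGroup.cmDatum L 1 (Matrix.of fun i j : Fin 1 => if i.val + j.val + 1 = 1 then (1 : L) else 0)).Local v) ⧸ Subgroup.centralizer ({a} : Set ((UnitaryGroup.cmDatum L 2 (Matrix.of fun i j : Fin 2 => if i.val + j.val + 1 = 2 then (1 : L) else 0)).Local v × (UnitaryGroup.cmDatum L 1 (Matrix.of fun i j : Fin 1 => if i.val + j.val + 1 = 1 then (1 : L) else 0)).Local v)))]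
      [∀ a : ((UnitaryGroup.cmDatum L 2 (Matrix.of fun i j : Fin 2 => if i.val + j.val + 1 = 2 then (1 : L) else 0)).Local v × (UnitaryGroup.cmDatum L 1 (Matrix.of fun i j : Fin 1 => if i.val + j.val + 1 = 1 then (1 : L) else 0)).Local v), BorelSpace (((UnitaryGroup.cmDatum L 2 (Matrix.of fun i j : Fin 2 => if i.val + j.val + 1 = 2 then (1 : L) else 0)).Local v × (UnitaryGroup.cmDatum L 1 (Matrix.of fun i j : Fin 1 => if i.val + j.val + 1 = 1 then (1 : L) else 0)).Local v) ⧸ Subgroup.centralizer ({a} : Set ((UnitaryGroup.cmDatum L 2 (Matrix.of fun i j : Fin 2 => if i.val + j.val + 1 = 2 then (1 : L) else 0)).Local v × (UnitaryGroup.cmDatum L 1 (Matrix.of fun i j : Fin 1 => if i.val + j.val + 1 = 1 then (1 : L) else 0)).Local v)))]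
      (νH : Measure ((UnitaryGroup.cmDatum L 2 (Matrix.of fun i j : Fin 2 => if i.val + j.val + 1 = 2 then (1 : L) else 0)).Local v × (UnitaryGroup.cmDatum L 1 (Matrix.of fun i j : Fin 1 => if i.val + j.val + 1 = 1 then (1 : L) else 0)).Local v)) [νH.IsHaarMeasure] [νH.IsMulRightInvariant]
      (mH : OrbitalMeasureFamily ((UnitaryGroup.cmDatum L 2 (Matrix.of fun i j : Fin 2 => if i.val + j.val + 1 = 2 then (1 : L) else 0)).Local v × (UnitaryGroup.cmDatum L 1 (Matrix.of fun i j : Fin 1 => if i.val + j.val + 1 = 1 then (1 : L) else 0)).Local v))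
      (hmH : mH.IsCanonical (IsLocalGRegular L v) νH),
      ∃ V ∈ 𝓝 (1 : ((UnitaryGroup.cmDatum L 2 (Matrix.of fun i j : Fin 2 => if i.val + j.val + 1 = 2 then (1 : L) else 0)).Local v × (UnitaryGroup.cmDatum L 1 (Matrix.of fun i j : Fin 1 => if i.val + j.val + 1 = 1 then (1 : L) else 0)).Local v)),
        ∀ γH ∈ V, IsLocalGRegular L v γH →
        (∃ (y : ((UnitaryGroup.cmDatum L 2 (Matrix.of fun i j : Fin 2 => if i.val + j.val + 1 = 2 then (1 : L) else 0)).Local v × (UnitaryGroup.cmDatum L 1 (Matrix.of fun i j : Fin 1 => if i.val + j.val + 1 = 1 then (1 : L) else 0)).Local v)) (d' : Fin 2 → (UnitaryGroup.LocalRing L v)ˣ),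
            glDiagonal 2 (UnitaryGroup.LocalRing L v) d' = ((y * γH * y⁻¹).1.val : GL (Fin 2) (UnitaryGroup.LocalRing L v))) →
        (νH.real (Function.support (hFamily L w hw ϖ 0)) : ℂ) * stableOrbitalIntegralRel (IsLocalStablyConjH L v) mH (hFamily L w hw ϖ 1) γH =
          (νH.real (Function.support (hFamily L w hw ϖ 1)) : ℂ) * stableOrbitalIntegralRel (IsLocalStablyConjH L v) mH (hFamily L w hw ϖ 0) γH := by
  intro L _ _ _ v w hw he _h2 ϖ hϖ _ _ _ _ νH _ _ mH hmH
  -- the uniform neighbourhood: on `V`, Levi witnesses are `ϖ`-deep (★ p855542 §1)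
  have hϖ0 : ϖ ≠ 0 := by
    intro h; rw [h, map_zero] at hϖ; exact WithZero.zero_ne_coe hϖ
  have hlt : Valued.v ϖ < 1 := by rw [hϖ, ← WithZero.exp_zero]; exact WithZero.exp_lt_exp.2 (by norm_num)
  obtain ⟨V, hV, hdeep⟩ := exists_nhds_one_forall_levi_valued_sub_one_le L v w hϖ0
  refine ⟨V, hV, fun γH hγ hreg hlevi => ?_⟩
  obtain ⟨y, d', hyd'⟩ := hlevi
  have hdk := hdeep γH hγ y _ (endoEmbLocal_eq_glDiagonal_of_fst_eq L v (y * γH * y⁻¹) hyd')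
  have ht1 : ∀ i : Fin 2, Valued.v ((((d' i : (UnitaryGroup.LocalRing L v)ˣ) : UnitaryGroup.LocalRing L v) w) - 1) < 1 := by
    intro i
    fin_cases i
    · exact (hdk 0).trans_lt hlt
    · exact (hdk 2).trans_lt hlt
  -- `U₁ = U(Φ₁)(L⁺_v)` is its own integral level; the `K⁰`-membership in the one-place model
  have hK1 : cmLocalIntegralLevel L 1 (Matrix.of fun i j : Fin 1 => if i.val + j.val + 1 = 1 then (1 : L) else 0) v = ⊤ :=
    cmLocalIntegralLevel_one_eq_top_of_smul_eq L _ w hw (isUnit_placeForm_antidiagOne (E := L) 1 w.1)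
  have hd0 : ∀ g : (UnitaryGroup.cmDatum L 2 (Matrix.of fun i j : Fin 2 => if i.val + j.val + 1 = 2 then (1 : L) else 0)).Local v, g ∈ cmLocalIntegralLevel L 2 (Matrix.of fun i j : Fin 2 => if i.val + j.val + 1 = 2 then (1 : L) else 0) v ↔ (((localNonsplitEquiv (IsCMField.complexConj L) (Matrix.of fun i j : Fin 2 => if i.val + j.val + 1 = 2 then (1 : L) else 0) (IsCMField.complexConj_ne_one L) w hw) g : ↥(unitaryGroupOfForm (galAdicCompletionMap (L := L) (IsCMField.complexConj L) hw) (placeForm (Matrix.of fun i j : Fin 2 => if i.val + j.val + 1 = 2 then (1 : L) else 0) w.1))) : GL (Fin 2) (w.1.adicCompletion L)) ∈ glInt 2 (w.1.adicCompletion L) :=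
    fun g => mem_localIntegralLevel_iff_of_smul_eq (IsCMField.complexConj L) 2 (Matrix.of fun i j : Fin 2 => if i.val + j.val + 1 = 2 then (1 : L) else 0) (IsCMField.complexConj_ne_one L) w hw g
  -- the `h₀` row (F8), in `hFamily` dress, with `K₁ ↦ ⊤`
  have h0row : stableOrbitalIntegralRel (IsLocalStablyConjH L v) mH (hFamily L w hw ϖ 0) γH = _ :=
    stableOrbitalIntegralRel_indicator_prod_eq_of_levi_frame_of_nonsplit L v w hw νH hmH hreg y hyd' ht1
  rw [hK1] at h0row
  rw [support_hFamily_zero_eq L w hw ϖ, h0row]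
  -- the dichotomy of the ramified place: an anti-fixed unit (√u) or an anti-fixed uniformiser (√π)
  obtain ⟨α, hσα, hα | hα⟩ := exists_units_galAdicCompletionMap_complexConj_eq_neg_of_ramified L w hw he
  · -- √u-TYPE: `h₁` row ★ F5, volumes ★ F6 (with `η = ϖ`)
    obtain ⟨K₂, -, -, hd1', -, -, -⟩ := exists_vertexCover_of_ramified_wild L v w hw he (Units.mk0 ϖ hϖ0) hϖ
    have h1row : stableOrbitalIntegralRel (IsLocalStablyConjH L v) mH (hFamily L w hw ϖ 1) γH = _ :=
      stableOrbitalIntegralRel_chiSharp_eq_of_levi_frame_ramified_of_unit L v w hw νH he hα hσα ϖ hϖ hmH hreg y hyd' ht1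
    rw [hK1] at h1row
    have hvol := absNorm_add_one_mul_measureReal_vertexCover_one_prod_top_eq_of_unit L v w hw he hα hσα (Units.mk0 ϖ hϖ0) hϖ νH
      (cmLocalIntegralLevel L 2 (Matrix.of fun i j : Fin 2 => if i.val + j.val + 1 = 2 then (1 : L) else 0) v) hd0 (K₂ 1) hd1'
    rw [support_hFamily_one_eq L w hw ϖ (Units.mk0 ϖ hϖ0) rfl (K₂ 1) hd1', h1row]
    have hq1 : ((Ideal.absNorm v.asIdeal : ℂ) + 1) ≠ 0 := Nat.cast_add_one_ne_zero _
    have hvolC : ((Ideal.absNorm v.asIdeal : ℂ) + 1) * (νH.real ((((K₂ 1).prod (⊤ : Subgroup ((UnitaryGroup.cmDatum L 1 (Matrix.of fun i j : Fin 1 => if i.val + j.val + 1 = 1 then (1 : L) else 0)).Local v))) : Subgroup ((UnitaryGroup.cmDatum L 2 (Matrix.of fun i j : Fin 2 => if i.val + j.val + 1 = 2 then (1 : L) else 0)).Local v × (UnitaryGroup.cmDatum L 1 (Matrix.of fun i j : Fin 1 => if i.val + j.val + 1 = 1 then (1 : L) else 0)).Local v)) : Set ((UnitaryGroup.cmDatum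 L 2 (Matrix.of fun i j : Fin 2 => if i.val + j.val + 1 = 2 then (1 : L) else 0)).Local v × (UnitaryGroup.cmDatum L 1 (Matrix.of fun i j : Fin 1 => if i.val + j.val + 1 = 1 then (1 : L) else 0)).Local v)) : ℂ) =
        2 * (νH.real ((((cmLocalIntegralLevel L 2 (Matrix.of fun i j : Fin 2 => if i.val + j.val + 1 = 2 then (1 : L) else 0) v).prod (⊤ : Subgroup ((UnitaryGroup.cmDatum L 1 (Matrix.of fun i j : Fin 1 => if i.val + j.val + 1 = 1 then (1 : L) else 0)).Local v))) : Subgroup ((UnitaryGroup.cmDatum L 2 (Matrix.of fun i j : Fin 2 => if i.val + j.val + 1 = 2 then (1 : L) else 0)).Local v × (UnitaryGroup.cmDatum L 1 (Matrix.of fun i j : Fin 1 => if i.val + j.val + 1 = 1 then (1 : L) else 0)).Local v)) : Set ((UnitaryGroup.cmDatum L 2 (Matrix.of fun i j : Fin 2 => if i.val + j.val + 1 = 2 then (1 : L) else 0)).Local v × (UnitaryGroup.cmDatum L 1 (Matrix.of fun i j : Fin 1 => if i.val + j.val + 1 = 1 then (1 : L) else 0)).Local v)) : ℂ) := by exact_mod_cast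 hvol
    have hB : (νH.real ((((K₂ 1).prod (⊤ : Subgroup ((UnitaryGroup.cmDatum L 1 (Matrix.of fun i j : Fin 1 => if i.val + j.val + 1 = 1 then (1 : L) else 0)).Local v))) : Subgroup ((UnitaryGroup.cmDatum L 2 (Matrix.of fun i j : Fin 2 => if i.val + j.val + 1 = 2 then (1 : L) else 0)).Local v × (UnitaryGroup.cmDatum L 1 (Matrix.of fun i j : Fin 1 => if i.val + j.val + 1 = 1 then (1 : L) else 0)).Local v)) : Set ((UnitaryGroup.cmDatum L 2 (Matrix.of fun i j : Fin 2 => if i.val + j.val + 1 = 2 then (1 : L) else 0)).Local v × (UnitaryGroup.cmDatum L 1 (Matrix.of fun i j : Fin 1 => if i.val + j.val + 1 = 1 then (1 : L) else 0)).Local v)) : ℂ) =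
        2 * (νH.real ((((cmLocalIntegralLevel L 2 (Matrix.of fun i j : Fin 2 => if i.val + j.val + 1 = 2 then (1 : L) else 0) v).prod (⊤ : Subgroup ((UnitaryGroup.cmDatum L 1 (Matrix.of fun i j : Fin 1 => if i.val + j.val + 1 = 1 then (1 : L) else 0)).Local v))) : Subgroup ((UnitaryGroup.cmDatum L 2 (Matrix.of fun i j : Fin 2 => if i.val + j.val + 1 = 2 then (1 : L) else 0)).Local v × (UnitaryGroup.cmDatum L 1 (Matrix.of fun i j : Fin 1 => if i.val + j.val + 1 = 1 then (1 : L) else 0)).Local v)) : Set ((UnitaryGroup.cmDatum L 2 (Matrix.of fun i j : Fin 2 => if i.val + j.val + 1 = 2 then (1 : L) else 0)).Local v × (UnitaryGroup.cmDatum L 1 (Matrix.of fun i j : Fin 1 => if i.val + j.val + 1 = 1 then (1 : L) else 0)).Local v)) : ℂ) / ((Ideal.absNorm v.asIdeal : ℂ) + 1) := by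
      rw [eq_div_iff hq1]; linear_combination hvolC
    rw [hB]; ring
  · -- √π-TYPE: `h₁` row ★ p855329, volumes ★ F7 (with `η = α`, an anti-fixed uniformiser; `|α| = |ϖ|`)
    obtain ⟨K₂, -, -, hd1', -, -, -⟩ := exists_vertexCover_of_ramified_wild L v w hw he α hα
    have h1row : stableOrbitalIntegralRel (IsLocalStablyConjH L v) mH (hFamily L w hw ϖ 1) γH = _ :=
      stableOrbitalIntegralRel_chiSharp_eq_of_levi_frame_ramified_of_uniformizer L v w hw νH he hα hσα ϖ hϖ hmH hreg y hyd' ht1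
    rw [hK1] at h1row
    have hvol := two_mul_measureReal_vertexCover_one_prod_top_eq_of_uniformizer L v w hw he hα hσα α hα hσα νH
      (cmLocalIntegralLevel L 2 (Matrix.of fun i j : Fin 2 => if i.val + j.val + 1 = 2 then (1 : L) else 0) v) hd0 (K₂ 1) hd1'
    rw [support_hFamily_one_eq L w hw ϖ α (hα.trans hϖ.symm) (K₂ 1) hd1', h1row]
    have hvolC : 2 * (νH.real ((((K₂ 1).prod (⊤ : Subgroup ((UnitaryGroup.cmDatum L 1 (Matrix.of fun i j : Fin 1 => if i.val + j.val + 1 = 1 then (1 : L) else 0)).Local v))) : Subgroup ((UnitaryGroup.cmDatum L 2 (Matrix.of fun i j : Fin 2 => if i.val + j.val + 1 = 2 then (1 : L) else 0)).Local v × (UnitaryGroup.cmDatum L 1 (Matrix.of fun i j : Fin 1 => if i.val + j.val + 1 = 1 then (1 : L) else 0)).Local v)) : Set ((UnitaryGroup.cmDatum L 2 (Matrix.of fun i j : Fin 2 => if i.val + j.val + 1 = 2 then (1 : L) else 0)).Local v × (UnitaryGroup.cmDatum L 1 (Matrix.of fun i j : Fin 1 => if i.val + j.val + 1 = 1 then (1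 : L) else 0)).Local v)) : ℂ) =
        ((Ideal.absNorm v.asIdeal : ℂ) + 1) * (νH.real ((((cmLocalIntegralLevel L 2 (Matrix.of fun i j : Fin 2 => if i.val + j.val + 1 = 2 then (1 : L) else 0) v).prod (⊤ : Subgroup ((UnitaryGroup.cmDatum L 1 (Matrix.of fun i j : Fin 1 => if i.val + j.val + 1 = 1 then (1 : L) else 0)).Local v))) : Subgroup ((UnitaryGroup.cmDatum L 2 (Matrix.of fun i j : Fin 2 => if i.val + j.val + 1 = 2 then (1 : L) else 0)).Local v × (UnitaryGroup.cmDatum L 1 (Matrix.of fun i j : Fin 1 => if i.val + j.val + 1 = 1 then (1 : L) else 0)).Local v)) : Set ((UnitaryGroup.cmDatum L 2 (Matrix.of fun i j : Fin 2 => if i.val + j.val + 1 = 2 then (1 : L) else 0)).Local v × (UnitaryGroup.cmDatum L 1 (Matrix.of fun i j : Fin 1 => if i.val + j.val + 1 = 1 then (1 : L) else 0)).Local v)) : ℂ) := by exact_mod_cast hvol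
    have hB : (νH.real ((((K₂ 1).prod (⊤ : Subgroup ((UnitaryGroup.cmDatum L 1 (Matrix.of fun i j : Fin 1 => if i.val + j.val + 1 = 1 then (1 : L) else 0)).Local v))) : Subgroup ((UnitaryGroup.cmDatum L 2 (Matrix.of fun i j : Fin 2 => if i.val + j.val + 1 = 2 then (1 : L) else 0)).Local v × (UnitaryGroup.cmDatum L 1 (Matrix.of fun i j : Fin 1 => if i.val + j.val + 1 = 1 then (1 : L) else 0)).Local v)) : Set ((UnitaryGroup.cmDatum L 2 (Matrix.of fun i j : Fin 2 => if i.val + j.val + 1 = 2 then (1 : L) else 0)).Local v × (UnitaryGroup.cmDatum L 1 (Matrix.of fun i j : Fin 1 => if i.val + j.val + 1 = 1 then (1 : L) else 0)).Local v)) : ℂ) =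
        ((Ideal.absNorm v.asIdeal : ℂ) + 1) * (νH.real ((((cmLocalIntegralLevel L 2 (Matrix.of fun i j : Fin 2 => if i.val + j.val + 1 = 2 then (1 : L) else 0) v).prod (⊤ : Subgroup ((UnitaryGroup.cmDatum L 1 (Matrix.of fun i j : Fin 1 => if i.val + j.val + 1 = 1 then (1 : L) else 0)).Local v))) : Subgroup ((UnitaryGroup.cmDatum L 2 (Matrix.of fun i j : Fin 2 => if i.val + j.val + 1 = 2 then (1 : L) else 0)).Local v × (UnitaryGroup.cmDatum L 1 (Matrix.of fun i j : Fin 1 => if i.val + j.val + 1 = 1 then (1 : L) else 0)).Local v)) : Set ((UnitaryGroup.cmDatum L 2 (Matrix.of fun i j : Fin 2 => if i.val + j.val + 1 = 2 then (1 : L) else 0)).Local v × (UnitaryGroup.cmDatum L 1 (Matrix.of fun i j : Fin 1 => if i.val + j.val + 1 = 1 then (1 : L) else 0)).Local v)) : ℂ) / 2 := by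
      rw [eq_div_iff two_ne_zero]; linear_combination hvolC
    rw [hB]; ring

end Summit.HodgeConjecture.HodgeConjecture.Cruxes.H413.F0P3cDyRamHProfilesLeviRatio

end
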